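import Literature.NumberTheory.EllipticCurves.BSDSelmerKimPConverseSkeletonProofs
import HarnessLib

/-!
# Castella–Wan, Math. Ann. 389 (2024), Theorem 6.10: the `Λ_ac`-module skeleton of the printed
# proof (± Heegner point main conjecture **in `Λ_ac[1/p]`** ⟹ `y_K` non-torsion), proved

Sibling proof file (theorems only; no definition, no named fact — D-0014/D-0026) of
`Literature.NumberTheory.EllipticCurves.CastellaWan2024.SupersingularPConverse` (the named fact
`thmA_analyticRank_eq_one_of_selmerCorank_eq_one` = Castella–Wan, Math. Ann. 389 (2024), Thm. A).
HONEST FRAMING (cell `b2b-bsdres`, off-peak literature typer `b2b-bsdres-lit-cw`): research routes, no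
claim beyond stated classes; this formalises the MODULE THEORY of one printed proof and asserts
nothing about any elliptic curve.

Source (authors' accepted manuscript `paper:url-7157bd4f7b88` of the journal text, MS p. 32),
**Theorem 6.10**: "Let `E/ℚ` be an elliptic curve of conductor `N`, `p > 3` a prime of good
supersingular reduction for `E`, and `K` an imaginary quadratic field satisfying hypotheses (gen-H)
and (spl). Assume that: (i) `N` is squarefree, (ii) some prime `ℓ ∣ N` is non-split in `K`, (iii) if
`N` is odd, then `2` splits in `K`. If `Sel_{p^∞}(E/K)` has `ℤ_p`-corank one, then `y_K` is
non-torsion." PRINTED PROOF (verbatim, MS p. 32): "Let `P₀ = ker(Λ_ac → ℤ_p)` be the augmentation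
ideal. Since `A^ac[P₀] = E[p^∞]` and `T^ac/P₀T^ac = T`, by Lemma 6.5 there are natural maps with
finite kernel and cokernel: `X_+/P₀X_+ → Sel_+(K, E[p^∞]) = Sel_{p^∞}(E/K)`,
`Sel_+(K, T^ac)/P₀Sel_+(K, T^ac) → Sel_+(K, T) = Š_p(E/K)` (6.16). By Theorem A.5 we have a
`Λ_ac`-module pseudo-isomorphism `X_+ ∼ Λ_ac ⊕ M ⊕ M` for some finitely generated torsion
`Λ_ac`-module `M`, and Theorem 6.9 gives the equality⁴ `char_{Λac}(M) = char_{Λac}(Sel_±(K, T^ac)/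
Λ_ac z^+_∞)` as ideals in `Λ_ac[1/p]`. Thus the assumption that `Sel_{p^∞}(E/K)` has `ℤ_p`-corank
`1` implies that `char_{Λac}(Sel_+(K, T^ac)/Λ_ac z^+_∞)` is not divisible by `P₀`, and hence,
denoting by `z^+_0` the image of `z^+_∞` in `Sel_+(K, T^ac)/P₀Sel_+(K, T^ac)`, it follows that `z₀`
generates a `ℤ_p`-submodule of `Sel_+(K, T^ac)/P₀Sel_+(K, T^ac)` of finite index. Since `Š_p(E/K)`
has `ℤ_p`-rank one by hypothesis, and by construction the class `z^+_0` is sent to the Kummer image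
of `y_K` in `Š_p(E/K)` under the second map in (6.16), the result follows." Footnote 4: "Note that
only the divisibility '⊆' coming from Theorem 5.3 is needed for this proof."

## What is proved, and how it differs from the tree's Wan-2021 skeleton

The tree's `IwasawaAlgebra.pow_smul_notMem_TSubmodule_of_charIdeal_le`
(`BSDSelmerPConverseHeegnerMainConjectureProofs`, X. Wan, Acta Math. Sin. 2021, Thm. 3.17 — the
ORDINARY Heegner point main conjecture) assumes the divisibility `char(M) ⊆ char(S/Λκ)` **in `Λ`**.
Castella–Wan's Theorem 6.9 delivers the ± Heegner point main conjecture only **in `Λ_ac[1/p]`**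
(equality in `Λ_ac` needs "`E[p]` ramified at every `ℓ ∣ N⁻`", which Theorem 6.10 does NOT assume),
i.e. `p^a · char(M) = p^b · char(S/Λκ)` for some `a, b`, of which the proof uses the one divisibility
`p^k · char(M) ⊆ char(S/Λκ)` (tree theorem `IwasawaAlgebra.exists_span_pow_mul_le_of_span_pow_mul_eq`,
C.-H. Kim 2022's "main conjecture inverting `p`" device). The theorems below are exactly the printed
argument with this weaker input, over `Λ = IwasawaAlgebra p = ℤ_[p]⟦T⟧` (`T ↔ γ_ac − 1`,
`P₀ = (T) = primeT p`, `N/P₀N = coinvariants p N`):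

* `pow_smul_notMem_TSubmodule_of_span_pow_mul_charIdeal_le` — DATA: `S` finitely generated
  torsion-free (`Sel_+(K, T^ac)`: `H¹(K, T^ac)` has trivial `Λ_ac`-torsion, MS p. 30, [PR00 §1.3.3]),
  `κ ∈ S` nonzero with `S/Λκ` torsion (`z^+_∞`, not `Λ_ac`-torsion by Cor. 6.4; `Sel_+(K, T^ac)` of
  `Λ_ac`-rank one by Thm. A.5); `M` finitely generated torsion and `φ : X → Λ ⊕ M ⊕ M` with finite
  cokernel (Thm. A.5 (i), `X = X_+`); `p^k · char(M) ⊆ char(S/Λκ)` for some `k` (Thm. 6.9 in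
  `Λ_ac[1/p]`, footnote 4); `rank_{ℤ_p} X/TX ≤ 1` ((6.16) with `corank_{ℤ_p} Sel_{p^∞}(E/K) = 1`;
  `rank_{ℤ_p} X/TX = corank` along a map with finite kernel and cokernel is the tree theorem
  `IwasawaAlgebra.coinvariantsRank_eq_of_finite_ker_coker`). CONCLUSION: `p^m κ ∉ TS` for all `m` —
  "`z₀` generates a `ℤ_p`-submodule … of finite index", in the form "the class of `z^+_∞` in
  `S/P₀S` is not `ℤ_p`-torsion". PROOF = the printed one: `M/P₀M` finite (Wan-skeleton Step 1,
  `finite_coinvariants_of_coinvariantsRank_le_one`: `2·rank M/P₀M + 1 ≤ rank X/P₀X ≤ 1`), hence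
  `P₀ ∤ f_M` (Greenberg LNM 1716 Lemma 4.2), hence `P₀ ∤ p^k f_M ∈ char(S/Λκ)` so `(S/Λκ)_{P₀} = 0`
  (Kim-skeleton `lengthAt_primeT_eq_zero_of_span_pow_mul_charIdeal_le`), hence the conclusion
  (Wan-skeleton Step 3) — packaged by the tree theorem
  `IwasawaAlgebra.pow_smul_notMem_TSubmodule_of_finite_coinvariants`.
* `pow_smul_mkQ_ne_zero_of_span_pow_mul_charIdeal_le` — the same in `S/P₀S`.
* `pow_smul_specialization_ne_zero_of_span_pow_mul_charIdeal_le` — "the class `z^+_0` is sent to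
  the Kummer image of `y_K` in `Š_p(E/K)` under the second map in (6.16)" (finite kernel): for any
  additive `sp : S/P₀S → H` with `p`-power-torsion kernel, `p^m • sp(z^+_0) ≠ 0` for all `m` — the
  Kummer image of `y_K` has infinite order, i.e. `y_K` is non-torsion.

What is NOT here: the objects (`Sel_±(K, T^ac)`, `z^±_∞`, `X_±`, `Š_p(E/K)`, `y_K` — see the
sibling's module docstring, "vocabulary gap"), Lemma 6.5, Theorem A.5, Theorem 6.9, and the
Gross–Zagier/YZZ step of Theorem 6.11; nothing is asserted about them.

## References
* [CastellaWan2023] F. Castella, X. Wan, Math. Ann. 389 (2024) 2595–2636, Thm. 6.10 and its proof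
  (incl. footnote 4), (6.16), Lemma 6.5, Thm. 6.9, Cor. 6.4, Thm. A.5 (authors' MS pp. 27, 30–32, 35–36).
* [Kim2022] C.-H. Kim, Math. Ann. 387 (2022), Assumption 2.5 / Remark 2.6 (the `Λ[1/p]` device; tree
  file `BSDSelmerKimPConverseSkeletonProofs`).
* [Wan2021HeegnerPointKolyvaginSystem] X. Wan, Acta Math. Sin. (Engl. Ser.) 37 (2021), Thm. 3.17
  (tree file `BSDSelmerPConverseHeegnerMainConjectureProofs`).
* [GreenbergLNM1716] R. Greenberg, LNM 1716 (1999), Lemma 4.2.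
-/

noncomputable section

open scoped Classical

universe u v w

namespace Literature.NumberTheory.EllipticCurves.CastellaWan2024

open Literature.NumberTheory.EllipticCurves.IwasawaAlgebra

variable (p : ℕ) [Fact p.Prime]

/-- **Castella–Wan 2024, Thm. 6.10 — module skeleton of the printed proof.** Over `Λ = ℤ_[p]⟦T⟧`
(`T ↔ γ_ac − 1`, `P₀ = (T)`) let `S` be finitely generated and torsion-free, `κ ∈ S` nonzero with
`S/Λκ` torsion (`S = Sel_+(K, T^ac) ∋ κ = z^+_∞`, Cor. 6.4, Thm. A.5); `M` finitely generated torsion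
with a `Λ`-linear `φ : X → Λ ⊕ M ⊕ M` of finite cokernel (`X = X_+ ∼ Λ_ac ⊕ M ⊕ M`, Thm. A.5 (i));
assume `p^k · char_Λ(M) ⊆ char_Λ(S/Λκ)` for some `k` — the ± Heegner point main conjecture of
Thm. 6.9 **as ideals in `Λ_ac[1/p]`**, of which "only the divisibility '⊆' coming from Theorem 5.3
is needed" (footnote 4) — and `rank_{ℤ_p} X/TX ≤ 1` ((6.16): `X_+/P₀X_+ → Sel_{p^∞}(E/K)^∨` with
finite kernel and cokernel, and `corank_{ℤ_p} Sel_{p^∞}(E/K) = 1`). Then `p^m κ ∉ TS` for every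
`m`: the class `z^+_0` of `z^+_∞` in `Sel_+(K, T^ac)/P₀` is not `ℤ_p`-torsion ("`z₀` generates a
`ℤ_p`-submodule … of finite index" in the rank-one `ℤ_p`-module). Proof as printed: `M/P₀M` finite
⟹ `P₀ ∤ char(M)` ⟹ `P₀ ∤ char(S/Λκ)` ⟹ conclusion (tree theorems
`finite_coinvariants_of_coinvariantsRank_le_one`, `pow_smul_notMem_TSubmodule_of_finite_coinvariants`).
[cite: CastellaWan2023, Thm. 6.10 (proof, incl. footnote 4), Thm. 6.9, Thm. A.5 (i); authors' MS pp. 31–32, 35] -/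
theorem pow_smul_notMem_TSubmodule_of_span_pow_mul_charIdeal_le {S : Type u} {X : Type v}
    {M : Type w}
    [AddCommGroup S] [Module (IwasawaAlgebra p) S] [Module.Finite (IwasawaAlgebra p) S]
    [NoZeroSMulDivisors (IwasawaAlgebra p) S]
    [AddCommGroup X] [Module (IwasawaAlgebra p) X] [Module.Finite (IwasawaAlgebra p) X]
    [AddCommGroup M] [Module (IwasawaAlgebra p) M] [Module.Finite (IwasawaAlgebra p) M]
    {κ : S} (hκ : κ ≠ 0)
    (hS : Module.IsTorsion (IwasawaAlgebra p) (S ⧸ Submodule.span (IwasawaAlgebra p) {κ}))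
    (hM : Module.IsTorsion (IwasawaAlgebra p) M)
    (φ : X →ₗ[IwasawaAlgebra p] (IwasawaAlgebra p × M × M))
    (hφ : Finite ((IwasawaAlgebra p × M × M) ⧸ LinearMap.range φ))
    (hMC : ∃ k : ℕ, Ideal.span {(p : IwasawaAlgebra p) ^ k} * Module.charIdeal (IwasawaAlgebra p) M ≤
      Module.charIdeal (IwasawaAlgebra p) (S ⧸ Submodule.span (IwasawaAlgebra p) {κ}))
    (hX : coinvariantsRank p X ≤ 1) (m : ℕ) :
    ((p : IwasawaAlgebra p) ^ m) • κ ∉ TSubmodule p S :=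
  pow_smul_notMem_TSubmodule_of_finite_coinvariants p hκ hS hM hMC
    (finite_coinvariants_of_coinvariantsRank_le_one p φ hφ hX) m

/-- The same conclusion in `S/P₀S = S/TS`: **`p^m • (κ mod TS) ≠ 0` for every `m`** (the class
`z^+_0` has infinite order). [cite: CastellaWan2023, Thm. 6.10 (proof); authors' MS p. 32] -/
theorem pow_smul_mkQ_ne_zero_of_span_pow_mul_charIdeal_le {S : Type u} {X : Type v} {M : Type w}
    [AddCommGroup S] [Module (IwasawaAlgebra p) S] [Module.Finite (IwasawaAlgebra p) S]
    [NoZeroSMulDivisors (IwasawaAlgebra p) S]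
    [AddCommGroup X] [Module (IwasawaAlgebra p) X] [Module.Finite (IwasawaAlgebra p) X]
    [AddCommGroup M] [Module (IwasawaAlgebra p) M] [Module.Finite (IwasawaAlgebra p) M]
    {κ : S} (hκ : κ ≠ 0)
    (hS : Module.IsTorsion (IwasawaAlgebra p) (S ⧸ Submodule.span (IwasawaAlgebra p) {κ}))
    (hM : Module.IsTorsion (IwasawaAlgebra p) M)
    (φ : X →ₗ[IwasawaAlgebra p] (IwasawaAlgebra p × M × M))
    (hφ : Finite ((IwasawaAlgebra p × M × M) ⧸ LinearMap.range φ))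
    (hMC : ∃ k : ℕ, Ideal.span {(p : IwasawaAlgebra p) ^ k} * Module.charIdeal (IwasawaAlgebra p) M ≤
      Module.charIdeal (IwasawaAlgebra p) (S ⧸ Submodule.span (IwasawaAlgebra p) {κ}))
    (hX : coinvariantsRank p X ≤ 1) (m : ℕ) :
    p ^ m • (Submodule.Quotient.mk κ : coinvariants p S) ≠ 0 :=
  pow_smul_mkQ_ne_zero_of_finite_coinvariants p hκ hS hM hMC
    (finite_coinvariants_of_coinvariantsRank_le_one p φ hφ hX) m

/-- **"… the class `z^+_0` is sent to the Kummer image of `y_K` in `Š_p(E/K)` under the second map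
in (6.16), the result follows"**: in the situation of
`pow_smul_notMem_TSubmodule_of_span_pow_mul_charIdeal_le`, for every additive `sp : S/TS → H`
whose kernel is `p`-power torsion (the map `Sel_+(K, T^ac)/P₀ → Sel_+(K, T) = Š_p(E/K)` of (6.16),
finite kernel by Lemma 6.5), the image `sp(κ mod TS)` — the Kummer image of `y_K` — satisfies
`p^m • sp(κ mod TS) ≠ 0` for all `m`: `y_K` is non-torsion.
[cite: CastellaWan2023, Thm. 6.10 (proof), (6.16), Lemma 6.5; authors' MS pp. 27, 32] -/
theorem pow_smul_specialization_ne_zero_of_span_pow_mul_charIdeal_le {S : Type u} {X : Type v}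
    {M : Type w} {H : Type*}
    [AddCommGroup S] [Module (IwasawaAlgebra p) S] [Module.Finite (IwasawaAlgebra p) S]
    [NoZeroSMulDivisors (IwasawaAlgebra p) S]
    [AddCommGroup X] [Module (IwasawaAlgebra p) X] [Module.Finite (IwasawaAlgebra p) X]
    [AddCommGroup M] [Module (IwasawaAlgebra p) M] [Module.Finite (IwasawaAlgebra p) M]
    [AddCommGroup H]
    {κ : S} (hκ : κ ≠ 0)
    (hS : Module.IsTorsion (IwasawaAlgebra p) (S ⧸ Submodule.span (IwasawaAlgebra p) {κ}))
    (hM : Module.IsTorsion (IwasawaAlgebra p) M)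
    (φ : X →ₗ[IwasawaAlgebra p] (IwasawaAlgebra p × M × M))
    (hφ : Finite ((IwasawaAlgebra p × M × M) ⧸ LinearMap.range φ))
    (hMC : ∃ k : ℕ, Ideal.span {(p : IwasawaAlgebra p) ^ k} * Module.charIdeal (IwasawaAlgebra p) M ≤
      Module.charIdeal (IwasawaAlgebra p) (S ⧸ Submodule.span (IwasawaAlgebra p) {κ}))
    (hX : coinvariantsRank p X ≤ 1)
    (sp : coinvariants p S →+ H) (hsp : ∀ x, sp x = 0 → ∃ n : ℕ, p ^ n • x = 0) (m : ℕ) :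
    p ^ m • sp (Submodule.Quotient.mk κ) ≠ 0 :=
  pow_smul_specialization_ne_zero_of_finite_coinvariants p hκ hS hM hMC
    (finite_coinvariants_of_coinvariantsRank_le_one p φ hφ hX) sp hsp m

/-- **From Theorem 6.9 as printed to the hypothesis `hMC`.** An EQUALITY of characteristic ideals
"as ideals in `Λ_ac[1/p]`" — `p^a · I = p^b · J` in `Λ` for some `a, b`, with `I = char(S/Λκ)`,
`J = char(M)` (Thm. 6.9, first clause) — yields the one divisibility `p^k · J ⊆ I` that the proof of
Thm. 6.10 uses (footnote 4); this is the tree theorem `exists_span_pow_mul_le_of_span_pow_mul_eq`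
(C.-H. Kim's Assumption 2.5 device), restated here so that the three theorems above apply verbatim
to Theorem 6.9's conclusion. [cite: CastellaWan2023, Thm. 6.9 and Thm. 6.10 (proof, footnote 4); authors' MS pp. 31–32] -/
theorem span_pow_mul_charIdeal_le_of_eq_in_localization {I J : Ideal (IwasawaAlgebra p)}
    (h : ∃ a b : ℕ, Ideal.span {(p : IwasawaAlgebra p) ^ a} * I =
      Ideal.span {(p : IwasawaAlgebra p) ^ b} * J) :
    ∃ k : ℕ, Ideal.span {(p : IwasawaAlgebra p) ^ k} * J ≤ I :=
  exists_span_pow_mul_le_of_span_pow_mul_eq p h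

end Literature.NumberTheory.EllipticCurves.CastellaWan2024

end
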